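import Summits.Parity.GeneralizedHardyLittlewood.Theorems.BeyondDiagonalBeatsQuarter.OffDiagCoreWinLevels
import Summits.Parity.GeneralizedHardyLittlewood.Theorems.BeyondDiagonalBeatsQuarter.OffDiagLevelWindowCompletion
import HarnessLib

/-!
# Route `PrimeLevelFamEdge`, crux K_B (stmt-Parity-20343), line `diagonal_kernel_split` rev 4, plan Ω,
# node **L7d part 2, leaf S₂ — the windowed level weight of a member FACTORED: convex cut × level-free weight ×
# universal prefactor × mollifier trinomial × box transform** (L7D-PLAN rev 5 §5 (3); companion of S₁, C, D3′, D5c)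

For a member `x = (cell, h₁, s)` of the windowed FL-family (`coreWin_largeKernel_eq_levelLargePart`) the level weight is
`q ↦ 𝟙[¬(T < |s + ab/(q(r+1))|)]·coreLevelWeight D (coreHeight ε₀) Δ′ x q`. At a PRIME level `q ≥ 40` exceeding `|h₁|`
(balanced cells: `|h₁| ≤ H* < N < q`) this equals

  `𝟙[coreRange_x q ∧ window_x q] · E_x · (2q̂(q)·2π/q) · (Σ_{e ∈ 3×3} t_{e₁}(l) t_{e₂}(m) u(q)^{e₁+e₂}) · Φ̂_{q,x}`

with the CONVEX cut `coreRange ∧ window` (leaf C), the LEVEL-FREE weight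
`E_x = 𝟙[h₁ unit mod (r+1) ∧ h₁ ≠ 0]·𝟙[adm_x]·D_x` (the unit cut no longer sees `q`: `isUnit_level_iff_of_abs_lt`), the
trinomial coefficients `t_a(n) = μ(n)ψ(n)⁻¹n^{−1/2}·{1, −2 log n, (log n)²}_a` of prover-8's
`mollifierCoeff_X_sq_eq_trinomial` and `u(q) = (log q̂(q)^{Δ′})⁻¹`:

* `trinomCoeff`, `mollifierCoeff_X_sq_eq_sum_trinomCoeff`, `mollifierCoeff_mul_eq_sum_trinomCoeff` (9 separated terms),
  `abs_trinomCoeff_le` (`≤ n^{−1/2}(1 + log n)²`);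
* **`window_coreLevelWeight_eq_factored`** — the factorisation above.

Pure algebra; standard axioms. Helper toward `stub_offDiagBelowSlack_io`; closes nothing.
«The programme SEARCHES and TYPES; no claim about Landau–Siegel zeros, Theorems 1–2 of arXiv:2211.02515 or
a repaired Margin232 until a kernel theorem says so.»
-/

noncomputable section

open Finset Real Polynomial

namespace Summit.Parity.GeneralizedHardyLittlewood.Theorems.BeyondDiagonalBeatsQuarter.OffDiag

open Literature.NumberTheory.LFunctions Literature.NumberTheory.LFunctions.KMV2000
open Literature.NumberTheory.Sieve.FriedlanderIwaniecPrimes (fourier2)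
open PeterssonSplit (nearBoxes)
open LevelSeparation (mollifierCoeff_X_sq_eq_trinomial abs_moebius_mul_psi_inv_le_one)

/-! ### §1. The mollifier trinomial as a separated finite sum -/

/-- **Trinomial coefficients** of `mollifierCoeff X² M n` in `u = (log M)⁻¹`:
`t_0(n) = μ(n)ψ(n)⁻¹n^{−1/2}`, `t_1(n) = −2(log n)·t_0(n)`, `t_2(n) = (log n)²·t_0(n)` (and `0` beyond).
[cite: KowalskiMichelVanderKam2000, (8)–(9) p. 7 — derivation] -/
def trinomCoeff (n a : ℕ) : ℝ :=
  (ArithmeticFunction.moebius n : ℝ) * ((psi n)⁻¹ * (n : ℝ) ^ (-(1 / 2 : ℝ))) *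
    (if a = 0 then 1 else if a = 1 then -2 * Real.log n else if a = 2 then Real.log n ^ 2 else 0)

/-- `mollifierCoeff X² M n = Σ_{a<3} t_a(n)·((log M)⁻¹)^a` for `n ≠ 0`, `M > 0`, `log M ≠ 0`.
[cite: KowalskiMichelVanderKam2000, (8)–(9) p. 7 — derivation] -/
theorem mollifierCoeff_X_sq_eq_sum_trinomCoeff {M : ℝ} (hM : 0 < M) (hlogM : Real.log M ≠ 0) {n : ℕ} (hn : n ≠ 0) :
    mollifierCoeff (X ^ 2) M n = ∑ a ∈ Finset.range 3, trinomCoeff n a * (Real.log M)⁻¹ ^ a := by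
  rw [mollifierCoeff_X_sq_eq_trinomial hM hlogM hn, Finset.sum_range_succ, Finset.sum_range_succ,
    Finset.sum_range_succ, Finset.sum_range_zero]
  simp only [trinomCoeff]
  norm_num
  ring

/-- **The product of two mollifier coefficients is a 9-term separated sum**:
`c_l(M)c_m(M) = Σ_{e ∈ 3×3} t_{e₁}(l)t_{e₂}(m)·((log M)⁻¹)^{e₁+e₂}`. [cite: KowalskiMichelVanderKam2000, (8)–(9) p. 7 — derivation] -/
theorem mollifierCoeff_mul_eq_sum_trinomCoeff {M : ℝ} (hM : 0 < M) (hlogM : Real.log M ≠ 0) {l m : ℕ}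
    (hl : l ≠ 0) (hm : m ≠ 0) :
    mollifierCoeff (X ^ 2) M l * mollifierCoeff (X ^ 2) M m =
      ∑ e ∈ Finset.range 3 ×ˢ Finset.range 3, trinomCoeff l e.1 * trinomCoeff m e.2 * (Real.log M)⁻¹ ^ (e.1 + e.2) := by
  rw [mollifierCoeff_X_sq_eq_sum_trinomCoeff hM hlogM hl, mollifierCoeff_X_sq_eq_sum_trinomCoeff hM hlogM hm,
    Finset.sum_mul_sum, Finset.sum_product]
  exact Finset.sum_congr rfl fun a _ ↦ Finset.sum_congr rfl fun b _ ↦ by ring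

/-- `|t_a(n)| ≤ n^{−1/2}·(1 + log n)²` for `n ≥ 1`. [cite: KowalskiMichelVanderKam2000, (8) p. 7 — derivation] -/
theorem abs_trinomCoeff_le {n : ℕ} (hn : 1 ≤ n) (a : ℕ) :
    |trinomCoeff n a| ≤ (n : ℝ) ^ (-(1 / 2 : ℝ)) * (1 + Real.log n) ^ 2 := by
  have hlog : 0 ≤ Real.log n := Real.log_natCast_nonneg n
  have hpow : 0 ≤ (n : ℝ) ^ (-(1 / 2 : ℝ)) := by positivity
  have hμψ := abs_moebius_mul_psi_inv_le_one n
  have hbr : |(if a = 0 then (1 : ℝ) else if a = 1 then -2 * Real.log n else if a = 2 then Real.log n ^ 2 else 0)| ≤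
      (1 + Real.log n) ^ 2 := by
    split_ifs
    · rw [abs_one]; nlinarith
    · rw [abs_mul, abs_neg, abs_two, abs_of_nonneg hlog]; nlinarith
    · rw [abs_pow, abs_of_nonneg hlog]; nlinarith
    · rw [abs_zero]; positivity
  unfold trinomCoeff
  rw [abs_mul, show (ArithmeticFunction.moebius n : ℝ) * ((psi n)⁻¹ * (n : ℝ) ^ (-(1 / 2 : ℝ))) =
    ((ArithmeticFunction.moebius n : ℝ) * (psi n)⁻¹) * (n : ℝ) ^ (-(1 / 2 : ℝ)) by ring, abs_mul,
    abs_of_nonneg hpow]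
  calc _ ≤ 1 * (n : ℝ) ^ (-(1 / 2 : ℝ)) * (1 + Real.log n) ^ 2 := by gcongr
    _ = _ := by rw [one_mul]

/-! ### §2. The factorisation of the windowed level weight -/

open Classical in
/-- **The windowed level weight of a member, factored.** For a PRIME level `q ≥ 40` with `|h₁| < q`, `Δ′ > 0`, `l, m ≥ 1`,
any `ε₀`, selector `D`, window height `T`, cell `(r,l,m,d₁,d₂,i)` and `s`:
`𝟙[¬(T < |s + ab/(q(r+1))|)]·coreLevelWeight D (coreHeight ε₀) Δ′ x q
   = 𝟙[coreRange_x q ∧ ¬(T < |…|)] · (𝟙[h₁ unit mod (r+1) ∧ h₁ ≠ 0]·𝟙[adm_x]·D_x) · (2q̂(q)(2π/q))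
     · (Σ_e t_{e₁}(l)t_{e₂}(m)(log q̂(q)^{Δ′})^{−(e₁+e₂)}) · Φ̂_{q,x}(h₁/(q(r+1)), s/h₁ + ab/(h₁q(r+1)))`.
[cite: KowalskiMichelVanderKam2000, §6 p. 19, (8)–(9) p. 7 — derivation] -/
theorem window_coreLevelWeight_eq_factored {q : ℕ} (hq : q.Prime) (hq40 : 40 ≤ q) {Δ' : ℝ} (hΔ : 0 < Δ') (ε₀ : ℝ)
    (D : ℕ → ℕ → ℕ → ℕ → ℕ → ℕ × ℕ → ℤ → ℤ → ℂ) (T : ℕ) {r l m : ℕ} (hl : 1 ≤ l) (hm : 1 ≤ m) (d₁ d₂ : ℕ) (i : ℕ × ℕ)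
    {h₁ : ℤ} (hh : |h₁| < q) (s : ℤ) :
    (if (T : ℝ) < |(s : ℝ) + ((((l / d₁ : ℕ) : ℤ) * (m / d₂ : ℕ) : ℤ) : ℝ) / ((q * (r + 1) : ℕ) : ℝ)| then 0 else
      coreLevelWeight D (coreHeight ε₀) Δ' r l m d₁ d₂ i h₁ s q) =
      (if coreRange Δ' ε₀ r l m d₁ d₂ i h₁ q ∧
          ¬ ((T : ℝ) < |(s : ℝ) + ((((l / d₁ : ℕ) : ℤ) * (m / d₂ : ℕ) : ℤ) : ℝ) / ((q * (r + 1) : ℕ) : ℝ)|) then (1 : ℂ) else 0) *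
        ((if IsUnit ((h₁ : ℤ) : ZMod (r + 1)) ∧ h₁ ≠ 0 then (1 : ℂ) else 0) *
          (if ((switchGcd (r + 1) s h₁ : ℤ) ∣ ((l / d₁ : ℕ) : ℤ) * (m / d₂ : ℕ) ∧
              IsUnit (switchClass (r + 1) (((l / d₁ : ℕ) : ℤ) * (m / d₂ : ℕ)) s h₁)) then (1 : ℂ) else 0) *
          D r l m d₁ d₂ i h₁ s) *
        (2 * (qhat q : ℂ) * (2 * π / q)) *
        ((∑ e ∈ Finset.range 3 ×ˢ Finset.range 3,
          trinomCoeff l e.1 * trinomCoeff m e.2 * (Real.log (qhat q ^ Δ'))⁻¹ ^ (e.1 + e.2) : ℝ) : ℂ) *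
        fourier2 (boxWeight q d₁ d₂ (l / d₁) (m / d₂) (r + 1) i) (h₁ / (q * (r + 1) : ℕ))
          ((s : ℝ) / h₁ + (((l / d₁ : ℕ) : ℤ) * (m / d₂ : ℕ) : ℝ) / ((h₁ : ℝ) * (q * (r + 1) : ℕ))) := by
  -- the mollifier product as the trinomial sum
  have hs1 : 1 < qhat q := one_lt_qhat hq40
  have hM : 0 < qhat q ^ Δ' := Real.rpow_pos_of_pos (by linarith) _
  have hM1 : 1 < qhat q ^ Δ' := Real.one_lt_rpow hs1 hΔ
  have hlogM : Real.log (qhat q ^ Δ') ≠ 0 := (Real.log_pos hM1).ne'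
  have htri := mollifierCoeff_mul_eq_sum_trinomCoeff hM hlogM (l := l) (m := m) (by omega) (by omega)
  -- the unit cut at a prime level above `|h₁|`
  have hqc : 2 ≤ q * (r + 1) := le_trans (by omega) (Nat.le_mul_of_pos_right q (Nat.succ_pos r))
  have hunit : IsUnit ((h₁ : ℤ) : ZMod (q * (r + 1))) ↔ IsUnit ((h₁ : ℤ) : ZMod (r + 1)) ∧ h₁ ≠ 0 := by
    constructor
    · intro hu
      have hh₀ := ne_zero_of_isUnit_intCast hqc hu
      exact ⟨(isUnit_level_iff_of_abs_lt hq (r + 1) hh₀ hh).mp hu, hh₀⟩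
    · rintro ⟨hu, hh₀⟩
      exact (isUnit_level_iff_of_abs_lt hq (r + 1) hh₀ hh).mpr hu
  by_cases hwin : (T : ℝ) < |(s : ℝ) + ((((l / d₁ : ℕ) : ℤ) * (m / d₂ : ℕ) : ℤ) : ℝ) / ((q * (r + 1) : ℕ) : ℝ)|
  · rw [if_pos hwin, if_neg (fun h ↦ h.2 hwin)]
    simp only [zero_mul]
  rw [if_neg hwin]
  unfold coreLevelWeight levelSummand coreRange
  beta_reduce
  by_cases hH : |h₁| ≤ (coreHeight ε₀ q d₁ d₂ (l / d₁) (m / d₂) (r + 1) i : ℤ)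
  swap
  · rw [if_neg hH, if_neg (fun h ↦ hH h.1.2.2.2.2)]
    simp only [zero_mul]
  rw [if_pos hH]
  by_cases hu : IsUnit ((h₁ : ℤ) : ZMod (q * (r + 1)))
  swap
  · rw [if_neg hu, if_neg (fun h ↦ hu (hunit.mpr h))]
    simp only [zero_mul, mul_zero]
  rw [if_pos hu, if_pos (hunit.mp hu)]
  by_cases hadm : ((switchGcd (r + 1) s h₁ : ℤ) ∣ ((l / d₁ : ℕ) : ℤ) * (m / d₂ : ℕ) ∧
      IsUnit (switchClass (r + 1) (((l / d₁ : ℕ) : ℤ) * (m / d₂ : ℕ)) s h₁))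
  swap
  · rw [if_neg hadm, if_neg hadm]
    simp only [zero_mul, mul_zero]
  rw [if_pos hadm, if_pos hadm]
  by_cases hrng : r < q ^ 7 ∧ l ≤ ⌊qhat q ^ Δ'⌋₊ ∧ m ≤ ⌊qhat q ^ Δ'⌋₊ ∧ i ∈ nearBoxes q d₁ d₂ (Real.log q ^ 4)
  swap
  · rw [if_neg hrng, if_neg (fun h ↦ hrng ⟨h.1.1, h.1.2.1, h.1.2.2.1, h.1.2.2.2.1⟩)]
    simp only [zero_mul]
  rw [if_pos hrng, if_pos ⟨⟨hrng.1, hrng.2.1, hrng.2.2.1, hrng.2.2.2, hH⟩, hwin⟩, htri]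
  push_cast
  ring

end Summit.Parity.GeneralizedHardyLittlewood.Theorems.BeyondDiagonalBeatsQuarter.OffDiag
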